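import Mathlib
import Summits.NavierStokesRegularity.NavierStokesRegularity.Theses.BarrierStepRungThree

/-!
# Glue `WindowCertificateMargin → DisturbanceAbsorption → BarrierCertificate` (route BarrierStepRungThree)

Item `stmt-NavierStokesRegularity-23650` (`BarrierCertificateGlue`, support, the glue of the gen-1 split of
`BarrierCertificate`).  Clause plumbing: take the data of the margin certificate
(`R, θ, c, η, γ, M, i₀, α, X₀, n, kLo, v, g, r, q, ρ, env, Ψ, Φ, win, vf` and the gradient bound `Λ`), copy
every clause of `BarrierCertificate` verbatim, and produce the ROBUST decrease clause from
`DisturbanceAbsorption` at `x = win S`, `w =` the window restriction of `quadTerm(S)`, `d` the defect: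
the undisturbed decrease `≤ -2γ` on the region, `‖fderiv ℝ v (win S)‖ ≤ Λ` on `{v ≤ 0}`, `0 ≤ Φ`, and
the absorption budget `Λ·η·4^(kLo+j)·√Φ_j ≤ γ` are exactly its hypotheses.

This is a line on rung TL-M3 of the Tao ladder (a MODEL lattice statement); nothing here is a statement
about the Navier–Stokes equations, and no summit is proved by this file.
-/

-- the summit and the sub-problem share the name `NavierStokesRegularity` (single-conjunct summit, D-0017)
set_option linter.dupNamespace false

namespace Summit.NavierStokesRegularity.NavierStokesRegularity.Theorems

open Summit.NavierStokesRegularity.NavierStokesRegularity.Theses.BarrierStepRungThree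

/-- **BarrierCertificateGlue** (item `stmt-NavierStokesRegularity-23650` of route `BarrierStepRungThree`):
`WindowCertificateMargin → DisturbanceAbsorption → BarrierCertificate`.  Proof: destructure the margin
certificate, reuse every clause, and obtain the robust decrease clause
`(fderiv ℝ v (win S)) (fun i j => vf S i (kLo+j) + d i j) ≤ -γ` from `DisturbanceAbsorption` applied at
`x = win S`, `w = fun i j => vf S i (kLo+j)` (undisturbed decrease `≤ -2γ`), using `‖fderiv ℝ v (win S)‖ ≤ Λ`
(available since `v (win S) ≤ 0` on the region) and the budget clause. -/
theorem barrierCertificateGlue_proof : BarrierCertificateGlue := by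
  unfold BarrierCertificateGlue
  intro hW hD
  obtain ⟨R, θ, c, η, γ, M, i₀, α, X₀, n, kLo, v, g, r, q, ρ, env, Ψ, Φ, win, vf, Λ, hR, hα, hX₀, hθ0,
    hθ, hc, hη, hγ, hkLo, hkn, hwin, hvf, hv, hg, hΨ, hrq, hΦ, hM₁, hvd, hgd, hM, hfloor, hdec, hΛ, hΛ0,
    hbudget, htail, hgoal⟩ := hW
  refine ⟨R, θ, c, η, γ, M, i₀, α, X₀, n, kLo, v, g, r, q, ρ, env, Ψ, Φ, win, vf, hR, hα, hX₀, hθ0, hθ,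
    hc, hη, hγ, hkLo, hkn, hwin, hvf, hv, hg, hΨ, hrq, hΦ, hM₁, hvd, hgd, hM, hfloor, ?_, htail, hgoal⟩
  intro S F d hreg hgS hd
  have h2 : (fderiv ℝ v (win S)) (fun i j => vf S i (kLo + (j : ℕ))) ≤ -(2 * γ) := hdec S F hreg hgS
  have habs := hD n kLo η γ Λ v Φ (win S) (fun i j => vf S i (kLo + (j : ℕ))) d hγ.le hΛ0 h2
    (hΛ _ hreg.1) (fun j => (hΦ j).1) hbudget hd
  have heq : (fun (i : Fin 4) (j : Fin n) => vf S i (kLo + (j : ℕ)) + d i j) =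
      (fun (i : Fin 4) (j : Fin n) => vf S i (kLo + (j : ℕ))) + d := by
    funext i j
    rfl
  rw [heq]
  exact habs

end Summit.NavierStokesRegularity.NavierStokesRegularity.Theorems
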